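import Mathlib
import HarnessLib.Audit
import Summits.PneNP.PneNP.Theorems.PstarCoreBound
import Summits.PneNP.PneNP.Theorems.PstarChordEndgameTools
import Summits.PneNP.PneNP.Theorems.PstarNorCoreTools

/-!
# Tools for the NOR-core accounting lemma, generic in the centre set (ROUND-24, GAPTWO-PLAN v1 S4c): classes, centre degrees, boundary accounting

FRONTIER range-avoidance ladder, rung F-N3, ROUND 24 (cell `pnp-ideate`; restricted-model proof complexity — nothing here bears
on `P` versus `NP`).

Bookkeeping for the proof of the NOR-core accounting lemma (planner memo `CORE-BOUND-NOTES.md` §5) in a form GENERIC in the set `C`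
of "centre" outputs — so that it serves both typings of the NOR structure, `PstarNorCore.NorStructure` (centre = non-chords) and the
corrected `PstarLitNorCore.LitNorStructure` (centre = literal edges): the data used (`CoreData I J₀ C σ τ g₀`) are `C ⊆ J₀`, every
member of `C` holds `σ` or `τ` in an AND slot, every other output of `J₀` has its XOR pair joined by a `C`-path (`CAdj`), and a reader
`g₀ ∉ J₀` with AND pair `{σ, τ}`, `σ ≠ τ`.  Organised so that NO path/component decomposition of the centre graph is needed:

* (boundary accounting, XOR pairs and the fourth variable `oth` are reused from `PstarNorCoreTools`);
* the NOR setting: `xorPair`, the classes `cls σ` / `cls τ` (centre edges holding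
  `σ` / `τ` in an AND slot) and the fourth variable `oth`; by simple overlaps with the reader `g₀` every centre edge lies in exactly one
  class (`mem_cls_or`, `not_mem_cls_both`; `not_sigma_tau`), two edges of one class share no further variable (`cls_share`), so no XOR variable lies on
  three centre edges (`cdeg_le_two`);
* the handshake `sum_cdeg` / `two_mul_card_cen` (`2·#cen = η + 2ι`, `η`/`ι` = XOR variables of centre degree `1`/`2`) and
  `iota_le` (`ι ≤ 2·#cls σ`).

The expansion counts built on these are in `PstarNorCoreCounts`.
-/

set_option linter.dupNamespace false

open Finset Literature.Computability.Complexity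
open Summit.PneNP.PneNP.Theorems.PstarSALevel (varSet bdry BoundaryExpanding SimpleOverlap)
open Summit.PneNP.PneNP.Theorems.PstarGapLinearised (andPair andPair_subset_varSet)
open Summit.PneNP.PneNP.Theorems.PstarCentreFree (vars_mem_varSet)
open Summit.PneNP.PneNP.Theorems.PstarGapOneKills (exists_other_reader mem_andPair_of_slot)
open Summit.PneNP.PneNP.Theorems.PstarGapPeeling (not_mem_varSet_of_private)
open Summit.PneNP.PneNP.Theorems.PstarChordEndgameTools (not_two_shared mem_andPair_iff)
open Summit.PneNP.PneNP.Theorems.PstarCoreBound (XorClosed)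

open Summit.PneNP.PneNP.Theorems.PstarNorCoreTools (not_mem_bdry_of_two card_varSet_inter_bdry_le card_bdry_le_sum eq_of_mem_bdry xorPair
  mem_xorPair_iff xorPair_subset_varSet card_xorPair_le vars_zero_ne_one card_xorPair xor_ne_and not_mem_andPair_of_mem_xorPair
  ne_of_xorPair_eq oth)

namespace Summit.PneNP.PneNP.Theorems.PstarNorDataTools

variable {n m : ℕ}

/-- ADJACENCY through the centre set `C`: `{v, v'}` is the XOR pair of a member of `C`. -/
def CAdj (I : LocalMap 4 n m) (C : Finset (Fin m)) (v v' : Fin n) : Prop :=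
  ∃ f ∈ C, (I.vars f 0 = v ∧ I.vars f 1 = v') ∨ (I.vars f 0 = v' ∧ I.vars f 1 = v)

/-- **The combinatorial NOR data**, generic in the centre set: `C ⊆ J₀`; `σ ≠ τ`; a reader `g₀ ∉ J₀` with AND pair `{σ, τ}`; every
member of `C` holds `σ` or `τ` in an AND slot; every other output of `J₀` has its XOR pair joined by a `C`-path. -/
def CoreData (I : LocalMap 4 n m) (J₀ C : Finset (Fin m)) (σ τ : Fin n) (g₀ : Fin m) : Prop :=
  C ⊆ J₀ ∧ σ ≠ τ ∧ g₀ ∉ J₀ ∧ ((I.vars g₀ 2 = σ ∧ I.vars g₀ 3 = τ) ∨ (I.vars g₀ 2 = τ ∧ I.vars g₀ 3 = σ)) ∧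
    (∀ f ∈ C, I.vars f 2 = σ ∨ I.vars f 2 = τ ∨ I.vars f 3 = σ ∨ I.vars f 3 = τ) ∧
    (∀ e ∈ J₀, e ∉ C → Relation.ReflTransGen (CAdj I C) (I.vars e 0) (I.vars e 1))

section Nor

variable (I : LocalMap 4 n m) (C : Finset (Fin m))

/-- The CLASS of `σ`: centre edges holding `σ` in an AND slot. -/
def cls (σ : Fin n) : Finset (Fin m) := C.filter fun f => σ ∈ andPair I f

/-- The CENTRE DEGREE of a variable: the number of centre edges holding it in an XOR slot. -/
def cdeg (v : Fin n) : ℕ := (C.filter fun f => v ∈ xorPair I f).card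

/-- Membership in a class. -/
theorem mem_cls {σ : Fin n} {f : Fin m} : f ∈ cls I C σ ↔ f ∈ C ∧ σ ∈ andPair I f := mem_filter

/-- A class consists of centre edges. -/
theorem cls_subset (σ : Fin n) : cls I C σ ⊆ C := filter_subset _ _

omit I in
/-- `#C + #(J₀ ∖ C) = #J₀` for `C ⊆ J₀`. -/
theorem card_cen_add_card_chd {J₀ : Finset (Fin m)} (hC : C ⊆ J₀) : C.card + (J₀ \ C).card = J₀.card := by
  rw [add_comm]
  exact card_sdiff_add_card_eq_card hC

omit I C in
/-- A centre edge and a non-centre output differ. -/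
theorem ne_of_mem_of_mem_sdiff {C J₀ : Finset (Fin m)} {f e : Fin m} (hf : f ∈ C) (he : e ∈ J₀ \ C) : f ≠ e := by
  rintro rfl
  exact (mem_sdiff.1 he).2 hf

variable {I C} {J₀ : Finset (Fin m)}
variable (hI : I.IsPure xorAndPred) (hS : SimpleOverlap I) {σ τ : Fin n} {g₀ : Fin m} (hN : CoreData I J₀ C σ τ g₀)
include hN

/-- The reader `g₀` holds `σ` (generic NOR data). -/
theorem sigma_mem_reader : σ ∈ varSet I g₀ := by
  rcases hN.2.2.2.1 with ⟨h2, -⟩ | ⟨-, h3⟩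
  · exact h2 ▸ vars_mem_varSet I g₀ 2
  · exact h3 ▸ vars_mem_varSet I g₀ 3

/-- The reader `g₀` holds `τ` (generic NOR data). -/
theorem tau_mem_reader : τ ∈ varSet I g₀ := by
  rcases hN.2.2.2.1 with ⟨-, h3⟩ | ⟨h2, -⟩
  · exact h3 ▸ vars_mem_varSet I g₀ 3
  · exact h2 ▸ vars_mem_varSet I g₀ 2

/-- The NOR data are symmetric in `(σ, τ)`. -/
theorem coreData_symm : CoreData I J₀ C τ σ g₀ := by
  obtain ⟨hC, hne, hg, hpair, hcen, hch⟩ := hN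
  refine ⟨hC, hne.symm, hg, hpair.symm, fun f hf => ?_, hch⟩
  rcases hcen f hf with h | h | h | h
  · exact Or.inr (Or.inl h)
  · exact Or.inl h
  · exact Or.inr (Or.inr (Or.inr h))
  · exact Or.inr (Or.inr (Or.inl h))

include hS

/-- **Simple overlaps with the reader** (generic NOR data): an output of `J₀` holding `σ` does not hold `τ`. -/
theorem not_sigma_tau {f : Fin m} (hf : f ∈ J₀) (hσ : σ ∈ varSet I f) (hτ : τ ∈ varSet I f) : False := by
  have hne : f ≠ g₀ := by rintro rfl; exact hN.2.2.1 hf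
  exact not_two_shared I hS hne hN.2.1 hσ (sigma_mem_reader hN) hτ (tau_mem_reader hN)

omit hS in
/-- Every centre edge lies in the class of `σ` or in the class of `τ`. -/
theorem mem_cls_or {f : Fin m} (hf : f ∈ C) : f ∈ cls I C σ ∨ f ∈ cls I C τ := by
  rcases hN.2.2.2.2.1 f hf with h | h | h | h
  · exact Or.inl ((mem_cls I C).2 ⟨hf, h ▸ mem_andPair_of_slot I f 2 (by decide)⟩)
  · exact Or.inr ((mem_cls I C).2 ⟨hf, h ▸ mem_andPair_of_slot I f 2 (by decide)⟩)
  · exact Or.inl ((mem_cls I C).2 ⟨hf, h ▸ mem_andPair_of_slot I f 3 (by decide)⟩)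
  · exact Or.inr ((mem_cls I C).2 ⟨hf, h ▸ mem_andPair_of_slot I f 3 (by decide)⟩)

/-- No centre edge lies in both classes. -/
theorem not_mem_cls_both {f : Fin m} (hσ : f ∈ cls I C σ) (hτ : f ∈ cls I C τ) : False := by
  obtain ⟨hf, hσ'⟩ := (mem_cls I C).1 hσ
  obtain ⟨-, hτ'⟩ := (mem_cls I C).1 hτ
  exact not_sigma_tau hS hN (hN.1 hf) (andPair_subset_varSet I f hσ') (andPair_subset_varSet I f hτ')

omit hN in
/-- **Classes are matchings**: two distinct edges of the class of `σ` share no variable other than `σ`. -/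
theorem cls_share {f f' : Fin m} (hf : f ∈ cls I C σ) (hf' : f' ∈ cls I C σ) (hne : f ≠ f') {v : Fin n} (hvσ : v ≠ σ)
    (hv : v ∈ varSet I f) (hv' : v ∈ varSet I f') : False := by
  obtain ⟨-, h1⟩ := (mem_cls I C).1 hf
  obtain ⟨-, h2⟩ := (mem_cls I C).1 hf'
  exact not_two_shared I hS hne hvσ hv hv' (andPair_subset_varSet I f h1) (andPair_subset_varSet I f' h2)

include hI

/-- An XOR variable of a centre edge is neither `σ` nor `τ`. -/
theorem xor_ne_sigma {f : Fin m} (hf : f ∈ C) {v : Fin n} (hv : v ∈ xorPair I f) : v ≠ σ ∧ v ≠ τ := by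
  have key : ∀ {ρ ρ' : Fin n}, f ∈ cls I C ρ → (ρ' = ρ ∨ ¬ (ρ ∈ varSet I f ∧ ρ' ∈ varSet I f)) → v ≠ ρ' := by
    intro ρ ρ' hρ h hv'
    subst hv'
    obtain ⟨-, hρa⟩ := (mem_cls I C).1 hρ
    rcases h with rfl | h
    · exact not_mem_andPair_of_mem_xorPair I hI f hv hρa
    · exact h ⟨andPair_subset_varSet I f hρa, xorPair_subset_varSet I f hv⟩
  have hfJ := hN.1 hf
  rcases mem_cls_or hN hf with h | h
  · exact ⟨key h (Or.inl rfl), key h (Or.inr fun h' => not_sigma_tau hS hN hfJ h'.1 h'.2)⟩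
  · refine ⟨key h (Or.inr fun h' => not_sigma_tau hS hN hfJ h'.2 h'.1), key h (Or.inl rfl)⟩

/-- **No XOR variable lies on three centre edges** (two of them would be in one class and share it besides the class variable). -/
theorem cdeg_le_two (v : Fin n) : cdeg I C v ≤ 2 := by
  classical
  by_contra h
  have h3 : 2 < ((C).filter fun f => v ∈ xorPair I f).card := by unfold cdeg at h; omega
  obtain ⟨a, ha, b, hb, c, hc, hab, hac, hbc⟩ := two_lt_card.1 h3
  rw [mem_filter] at ha hb hc
  -- two of the three lie in one class
  have key : ∀ {f f' : Fin m}, f ∈ C → v ∈ xorPair I f → f' ∈ C → v ∈ xorPair I f' → f ≠ f' →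
      ∀ ρ ∈ ({σ, τ} : Finset (Fin n)), f ∈ cls I C ρ → f' ∈ cls I C ρ → False := by
    intro f f' hf hv hf' hv' hne ρ hρ h1 h2
    have hvρ : v ≠ ρ := by
      rw [mem_insert, mem_singleton] at hρ
      rcases hρ with rfl | rfl
      · exact (xor_ne_sigma hI hS hN hf hv).1
      · exact (xor_ne_sigma hI hS hN hf hv).2
    rw [mem_insert, mem_singleton] at hρ
    rcases hρ with rfl | rfl
    · exact cls_share hS h1 h2 hne hvρ (xorPair_subset_varSet I f hv) (xorPair_subset_varSet I f' hv')
    · exact cls_share hS h1 h2 hne hvρ (xorPair_subset_varSet I f hv) (xorPair_subset_varSet I f' hv')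
  have hσm : σ ∈ ({σ, τ} : Finset (Fin n)) := mem_insert_self _ _
  have hτm : τ ∈ ({σ, τ} : Finset (Fin n)) := mem_insert_of_mem (mem_singleton_self _)
  rcases mem_cls_or hN ha.1 with h1 | h1 <;> rcases mem_cls_or hN hb.1 with h2 | h2 <;>
    rcases mem_cls_or hN hc.1 with h4 | h4
  · exact key ha.1 ha.2 hb.1 hb.2 hab σ hσm h1 h2
  · exact key ha.1 ha.2 hb.1 hb.2 hab σ hσm h1 h2
  · exact key ha.1 ha.2 hc.1 hc.2 hac σ hσm h1 h4
  · exact key hb.1 hb.2 hc.1 hc.2 hbc τ hτm h2 h4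
  · exact key hb.1 hb.2 hc.1 hc.2 hbc σ hσm h2 h4
  · exact key ha.1 ha.2 hc.1 hc.2 hac τ hτm h1 h4
  · exact key ha.1 ha.2 hb.1 hb.2 hab τ hτm h1 h2
  · exact key ha.1 ha.2 hb.1 hb.2 hab τ hτm h1 h2

omit hI hS in
/-- The AND pair of a centre edge consists of its class variable and its fourth variable. -/
theorem andPair_subset_oth {f : Fin m} (hf : f ∈ C) : andPair I f ⊆ {σ, τ, oth I σ τ f} := by
  intro v hv
  rw [mem_andPair_iff] at hv
  have hslot := hN.2.2.2.2.1 f hf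
  simp only [mem_insert, mem_singleton, oth]
  rcases hv with rfl | rfl
  · by_cases h : I.vars f 2 = σ ∨ I.vars f 2 = τ
    · rcases h with h | h
      · exact Or.inl h
      · exact Or.inr (Or.inl h)
    · rw [if_neg h]; exact Or.inr (Or.inr rfl)
  · by_cases h : I.vars f 2 = σ ∨ I.vars f 2 = τ
    · rw [if_pos h]; exact Or.inr (Or.inr rfl)
    · rw [if_neg h]
      push Not at h
      rcases hslot with h' | h' | h' | h'
      · exact absurd h' h.1
      · exact absurd h' h.2
      · exact Or.inl h'
      · exact Or.inr (Or.inl h')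

omit hI hS hN in
/-- Two edges in the class of `σ` make `σ` non-private in any family containing them. -/
theorem sigma_not_mem_bdry {X : Finset (Fin m)} (hX : cls I C σ ⊆ X) (h2 : 2 ≤ (cls I C σ).card) : σ ∉ bdry I X := by
  classical
  have h1 : 1 < (cls I C σ).card := by omega
  obtain ⟨f, hf, f', hf', hne⟩ := one_lt_card.1 h1
  exact not_mem_bdry_of_two I (hX hf) (hX hf') hne (andPair_subset_varSet I f ((mem_cls I C).1 hf).2)
    (andPair_subset_varSet I f' ((mem_cls I C).1 hf').2)

/-! ## The handshake for centre degrees -/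

omit hS hN in
/-- `Σ_v cdeg v = 2·#cen`. -/
theorem sum_cdeg : ∑ v, cdeg I C v = 2 * (C).card := by
  classical
  unfold cdeg
  simp_rw [card_filter]
  rw [sum_comm]
  have : ∀ f ∈ C, (∑ v : Fin n, if v ∈ xorPair I f then 1 else 0) = 2 := fun f _ => by
    rw [sum_boole, Nat.cast_id]
    have : (univ.filter fun v : Fin n => v ∈ xorPair I f) = xorPair I f := by ext v; simp
    rw [this, card_xorPair I hI f]
  rw [sum_congr rfl this, sum_const, smul_eq_mul, mul_comm]

/-- **Handshake**: `2·#cen = η + 2ι` with `η`, `ι` the numbers of XOR variables of centre degree `1`, `2`. -/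
theorem two_mul_card_cen : 2 * (C).card =
    (univ.filter fun v => cdeg I C v = 1).card + 2 * (univ.filter fun v => cdeg I C v = 2).card := by
  classical
  rw [← sum_cdeg hI]
  have hpt : ∀ v : Fin n, cdeg I C v = (if cdeg I C v = 1 then 1 else 0) + 2 * (if cdeg I C v = 2 then 1 else 0) := by
    intro v
    have := cdeg_le_two hI hS hN v
    interval_cases cdeg I C v <;> simp
  rw [sum_congr rfl fun v _ => hpt v, sum_add_distrib, ← mul_sum, sum_boole, sum_boole, Nat.cast_id, Nat.cast_id]

/-- A vertex of centre degree `2` lies on an edge of the class of `σ` (its two centre edges are in different classes). -/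
theorem exists_cls_of_cdeg_two {v : Fin n} (hv : cdeg I C v = 2) : ∃ f ∈ cls I C σ, v ∈ xorPair I f := by
  classical
  unfold cdeg at hv
  obtain ⟨f, f', hne, hff⟩ := card_eq_two.1 hv
  have hf : f ∈ (C).filter fun f => v ∈ xorPair I f := hff ▸ mem_insert_self _ _
  have hf' : f' ∈ (C).filter fun f => v ∈ xorPair I f := hff ▸ mem_insert_of_mem (mem_singleton_self _)
  rw [mem_filter] at hf hf'
  rcases mem_cls_or hN hf.1 with h | h
  · exact ⟨f, h, hf.2⟩
  rcases mem_cls_or hN hf'.1 with h' | h'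
  · exact ⟨f', h', hf'.2⟩
  exact absurd (cls_share hS h h' hne (xor_ne_sigma hI hS hN hf.1 hf.2).2
    (xorPair_subset_varSet I f hf.2) (xorPair_subset_varSet I f' hf'.2)) id

/-- **`ι ≤ 2·#cls σ`**: the vertices of centre degree `2` are covered by the XOR pairs of the class of `σ`. -/
theorem iota_le : (univ.filter fun v => cdeg I C v = 2).card ≤ 2 * (cls I C σ).card := by
  classical
  have hcov : (univ.filter fun v => cdeg I C v = 2) ⊆ (cls I C σ).biUnion (xorPair I) := by
    intro v hv
    rw [mem_filter] at hv
    obtain ⟨f, hf, hvf⟩ := exists_cls_of_cdeg_two hI hS hN hv.2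
    exact mem_biUnion.2 ⟨f, hf, hvf⟩
  calc (univ.filter fun v => cdeg I C v = 2).card ≤ ((cls I C σ).biUnion (xorPair I)).card := card_le_card hcov
    _ ≤ ∑ f ∈ cls I C σ, (xorPair I f).card := card_biUnion_le
    _ ≤ ∑ _f ∈ cls I C σ, 2 := sum_le_sum fun f _ => card_xorPair_le I f
    _ = 2 * (cls I C σ).card := by rw [sum_const, smul_eq_mul, mul_comm]

end Nor

end Summit.PneNP.PneNP.Theorems.PstarNorDataTools
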